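import Literature.AlgebraicGeometry.Modules.BoundedCoherentVBModelsProjective
import HarnessLib

/-!
# Bounded COHERENT representatives of bounded-coherent objects of `D⁺(Mod 𝒪_X)` (SGA 6 II Cor. 2.2.2.1: the functor
# `D^b(Coh X) → D^b_coh(Mod 𝒪_X)` is essentially surjective) — regularity-free

Layer `Literature/AlgebraicGeometry/Modules`. On a locally noetherian scheme `X`, let `E ∈ D⁺(Mod 𝒪_X)` have
coherent cohomology sheaves (`Morphisms/DevissageClass.Coh`), and let `E` be the class `Q⁺⟨M, n⟩` of a
complex `M` of QUASI-COHERENT (affine-localizing) modules. Then `E` is the class of a BOUNDED complex of COHERENT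
modules — granted the LIFTING PROPERTY `hlift` («every epimorphism from a quasi-coherent module onto a coherent module is
dominated by a coherent module», EGA I 9.4.9 on a noetherian scheme: a HYPOTHESIS of the general statements, DISCHARGED
on every projective `k`-scheme by Serre's theorem `Modules/QuasicoherentEpiDominatedByVectorBundle` — a finite locally
free module is coherent):

* §1 `exists_cohModel_of_qcRepresentative` — `M` bounded (`IsStrictlyGE n`, `IsStrictlyLE b`): the K-phase
  `Algebra/Homology/BoundedAboveResolution.exists_quasiIso_of_frontier_kernel` of
  `Modules/BoundedCoherentVBModelsOfRepresentative` RE-INSTANTIATED with the resolving class `𝒫 := coherent` (instead of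
  finite locally free; `𝒞` := affine-localizing, `𝒜'` := coherent): the frontier kernel of a complex of coherent
  modules is coherent (`KTheory/AdaptedResolution.coh_kernel`), so the phase terminates at ANY frontier below the support
  of `M` — no regularity, no dimension bound;
* §2 `exists_cohModel_of_qcRepresentative_of_isLE` — `M` bounded BELOW only, the upper bound put on the cohomology
  (`E.IsLE b`), via the canonical truncation `τ^{≤b}` (as in `exists_vbModel_of_qcRepresentative_of_isLE`);
* §3 **`IsProjectiveOver.exists_boundedCohComplex_of_boundedCoh`** — on a PROJECTIVE `k`-scheme (any field, any
  singularities): every `E ∈ D⁺(Mod 𝒪_X)` with `E.IsGE a`, `E.IsLE b` and coherent cohomology is `Q⁺⟨K, m, _⟩` for a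
  complex `K` of COHERENT modules concentrated in degrees `[m, b]` — Stage I
  (`Modules/BoundedCoherentVBModelsProjective.IsProjectiveOver.exists_qcRepresentative`) + §2 with `hlift` from
  `IsProjectiveOver.exists_isFiniteLocallyFree_epi_comp`.

Everything is PROVED; 0 named facts, no definitions, no instances. Typed for the cell `pub-hodge-ring2` as a
regularity-free companion of `IsProjectiveOver.exists_isBoundedVBComplex_of_boundedCoh_of_isRegular`; a research route
conditional on HC_CM, not a corollary — nothing in this file refers to it.
-- TODO(general form): `hlift` on an arbitrary noetherian scheme (EGA I 9.4.9: a quasi-coherent module is the union of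
-- its coherent submodules), giving SGA 6 II 2.2.2.1 for every noetherian scheme with Stage I (separated quasi-compact).

## References

* P. Berthelot, A. Grothendieck, L. Illusie, *SGA 6*, Exp. II, Cor. 2.2.2.1 (`D^b(Coh) ≃ D^b_coh`), Prop. 3.5. [SGA6]
* D. Huybrechts, *Fourier–Mukai transforms in algebraic geometry* (2006), Prop. 3.26 (p. 74: `D^b(X) := D^b(Coh X) →
  D^b_coh(Mod 𝒪_X)` an equivalence for `X` noetherian). [HuybrechtsFM2006]
* The Stacks Project, Tags 0FDA, 08E8 (`D^b(Coh 𝒪_X) = D^b_Coh(QCoh 𝒪_X)` for `X` noetherian), 0FCL. [StacksProject]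
* A. Grothendieck, J. Dieudonné, *EGA I* (1971 ed.), Cor. 9.4.9 (coherent submodules of a quasi-coherent module). [EGAInew]
* R. Hartshorne, *Residues and Duality*, LNM 20 (1966), I Lemma 4.6 (dual form), II Cor. 7.19. [HartshorneRD1966]
* U. Görtz, T. Wedhorn, *Algebraic Geometry II* (2023), Prop. 22.58, Lemma 22.36. [GortzWedhorn2023]
-/

noncomputable section

universe w u

open CategoryTheory CategoryTheory.Limits AlgebraicGeometry HomologicalComplex

namespace Literature.AlgebraicGeometry.Modules

open Literature.AlgebraicGeometry.Morphisms Literature.AlgebraicGeometry.Motives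
  Literature.AlgebraicGeometry.KTheory Literature.AlgebraicGeometry.KTheory.Adapted
  Literature.Algebra.Homology.BoundedAboveResolution

variable {X : Scheme.{u}} [IsLocallyNoetherian X]

/-! ## §1 A bounded coherent model of an object represented by a bounded complex of quasi-coherent modules -/

omit [IsLocallyNoetherian X] in
/-- A binary biproduct of coherent modules is coherent (split short exact sequence).
[cite: Hartshorne1977, II Prop. 5.7 (p. 114)] -/
private theorem coh_biprod'' {M N : X.Modules} (hM : Coh M) (hN : Coh N) : Coh (M ⊞ N) :=
  ⟨IsAffineLocalizing.biprod hM.loc hN.loc,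
    IsAffineFiniteType.of_shortExact₂ (ShortComplex.Splitting.ofHasBinaryBiproduct M N).shortExact hM.loc hM.ft hN.ft⟩

/-- **SGA 6 II 2.2.2.1 for objects with a BOUNDED quasi-coherent representative.** Let `X` be a locally noetherian
scheme with the lifting property `hlift` (every epimorphism from a quasi-coherent module onto a coherent module is
dominated by a coherent module — EGA I 9.4.9 on a noetherian scheme; a HYPOTHESIS here), `E ∈ D⁺(Mod 𝒪_X)` with
coherent cohomology sheaves, represented as `Q⁺⟨M, n, _⟩ ≅ E` by a complex `M` of quasi-coherent
modules with `Mⁱ = 0` for `i > b`. Then `E ≅ Q⁺⟨K, m, _⟩` for a complex `K` of COHERENT modules concentrated in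
degrees `[m, b]`. Proof: the K-phase `exists_quasiIso_of_frontier_kernel` with `𝒫 ∕ 𝒞 ∕ 𝒜'` := coherent ∕
affine-localizing ∕ coherent, whose termination condition (the frontier kernel lies in `𝒫`) is `coh_kernel`, closed
one degree below the support of `M` and transported to `D⁺` (`Functor.isIso_Q_map_of_quasiIso`).
[cite: SGA6, Exp. II Cor. 2.2.2.1] [cite: HuybrechtsFM2006, Prop. 3.26] [cite: StacksProject, Tag 0FDA]
[cite: GortzWedhorn2023, Prop. 22.58 (proof)] -/
theorem exists_cohModel_of_qcRepresentative [HasDerivedCategory.{w} X.Modules]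
    (hlift : ∀ {M N : X.Modules} (g : M ⟶ N) [Epi g], IsAffineLocalizing M → Coh N →
      ∃ (F : X.Modules) (p : F ⟶ M), Coh F ∧ Epi (p ≫ g))
    (E : DerivedCategory.Plus X.Modules)
    (hcoh : ∀ k : ℤ, Coh ((DerivedCategory.Plus.homologyFunctor _ k).obj E))
    (M : CochainComplex X.Modules ℤ) {n b : ℤ} (hn : M.IsStrictlyGE n) [M.IsStrictlyLE b]
    (hM : ∀ i, IsAffineLocalizing (M.X i)) (eM : DerivedCategory.Plus.Q.obj ⟨M, n, hn⟩ ≅ E) :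
    ∃ (K : CochainComplex X.Modules ℤ) (m : ℤ) (hm : K.IsStrictlyGE m),
      K.IsStrictlyLE b ∧ (∀ i, Coh (K.X i)) ∧ Nonempty (DerivedCategory.Plus.Q.obj ⟨K, m, hm⟩ ≅ E) := by
  haveI := hn
  -- the cohomology of `M` is that of `E`: coherent
  have eH : ∀ i, (DerivedCategory.Plus.homologyFunctor _ i).obj E ≅ M.homology i := fun i =>
    (DerivedCategory.Plus.homologyFunctor _ i).mapIso eM.symm ≪≫ plusHomologyFunctorQObjIso ⟨M, n, hn⟩ i
  have hMA' : ∀ i, Coh (M.homology i) := fun i => coh_of_iso' (eH i) (hcoh i)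
  -- the classes `𝒫 ∕ 𝒞 ∕ 𝒜'` := coherent ∕ affine-localizing ∕ coherent
  let P : ObjectProperty X.Modules := fun F => Coh F
  let 𝒞 : ObjectProperty X.Modules := fun F => IsAffineLocalizing F
  haveI hPi : P.IsClosedUnderIsomorphisms := ⟨fun e h => coh_of_iso' e h⟩
  haveI h𝒞i : 𝒞.IsClosedUnderIsomorphisms := ⟨fun e h => IsAffineLocalizing.of_iso e h⟩
  have hPA' : ∀ F, P F → P F := fun _ h => h
  have hA'𝒞 : ∀ F, P F → 𝒞 F := fun _ h => h.loc
  have hP0 : ∀ F : X.Modules, IsZero F → P F := fun _ h => coh_of_isZero' h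
  have hPB : ∀ F G : X.Modules, P F → P G → P (F ⊞ G) := fun _ _ hF hG => coh_biprod'' hF hG
  have hA'ker : ∀ {F G : X.Modules} (f : F ⟶ G), P F → P G → P (kernel f) := fun f hF hG => coh_kernel f hF hG
  have h𝒞ker : ∀ {F G : X.Modules} (f : F ⟶ G), 𝒞 F → 𝒞 G → 𝒞 (kernel f) :=
    fun f hF hG => IsAffineLocalizing.kernel f hF hG
  have h𝒞pb : ∀ {F G H : X.Modules} (f : F ⟶ H) (g : G ⟶ H), 𝒞 F → 𝒞 G → 𝒞 H → 𝒞 (pullback f g) :=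
    fun f g hF hG hH => IsAffineLocalizing.of_iso
      ((kernelIsKernel (biprod.desc f (-g))).conePointUniqueUpToIso
        (Abelian.PullbackToBiproductIsKernel.isLimitPullbackToBiproduct f g))
      (IsAffineLocalizing.kernel _ (IsAffineLocalizing.biprod hF hG) hH)
  -- the frontier: one degree below the support of `M` (no depth is needed: coherence of kernels is free)
  let f : ℤ := min n (b + 1) - 1
  have hterm : ∀ (L : CochainComplex X.Modules ℤ) (φ : L ⟶ M), (∀ i, P (L.X i)) → L.IsStrictlyLE b →
      (∀ i, i < f → IsZero (L.X i)) → (∀ i, f < i → QuasiIsoAt φ i) → P (kernel (L.d f (f + 1))) :=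
    fun L _ hP _ _ _ => coh_kernel _ (hP f) (hP (f + 1))
  obtain ⟨L, φ, hP, hLE, hz, hqi⟩ :=
    @exists_quasiIso_of_frontier_kernel _ _ _ P 𝒞 P hPi h𝒞i hPi hPA' hA'𝒞 hP0 hPB
      (fun f hF hG => hA'ker f hF hG) (fun f hF hG => h𝒞ker f hF hG) (fun f g hF hG hH => h𝒞pb f g hF hG hH)
      (fun g _ hF hG => hlift g hF hG) M b inferInstance hM hMA' f (by omega)
      (fun i hi => M.isZero_of_isStrictlyGE n i (by omega)) hterm
  haveI := hLE
  haveI := hqi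
  -- the bounded coherent complex and its class in `D⁺`
  have hm : L.IsStrictlyGE (f - 1) := by
    rw [CochainComplex.isStrictlyGE_iff]
    intro i hi
    exact hz i hi
  let φ' : (⟨L, f - 1, hm⟩ : CochainComplex.Plus X.Modules) ⟶ ⟨M, n, hn⟩ := ObjectProperty.homMk φ
  haveI : QuasiIso φ'.hom := hqi
  haveI := Functor.isIso_Q_map_of_quasiIso (C := X.Modules) φ'
  exact ⟨L, f - 1, hm, hLE, hP, ⟨asIso (DerivedCategory.Plus.Q.map φ') ≪≫ eM⟩⟩

/-! ## §2 Bounded-below quasi-coherent representatives: truncate at the cohomological upper bound -/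

/-- **SGA 6 II 2.2.2.1 for objects with a bounded-BELOW quasi-coherent representative.** As
`exists_cohModel_of_qcRepresentative`, with `M` only bounded below (`M.IsStrictlyGE n`, the output of the `D⁺_qc`
comparison) and the upper bound put on the COHOMOLOGY of `E` (`E.IsLE b`): the canonical truncation `τ^{≤b} M`
(Mathlib `CochainComplex.truncLE`; affine-localizing terms by `isAffineLocalizing_truncLE_X`, bounded, and
`τ^{≤b} M → M` a quasi-isomorphism since `M` is cohomologically `≤ b`) is a bounded quasi-coherent representative, to
which §1 applies; the coherent model lives in degrees `[m, b]`. [cite: SGA6, Exp. II Cor. 2.2.2.1] [cite: HuybrechtsFM2006, Prop. 3.26]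
[cite: StacksProject, Tag 0FDA and Tag 0118] -/
theorem exists_cohModel_of_qcRepresentative_of_isLE [HasDerivedCategory.{w} X.Modules]
    (hlift : ∀ {M N : X.Modules} (g : M ⟶ N) [Epi g], IsAffineLocalizing M → Coh N →
      ∃ (F : X.Modules) (p : F ⟶ M), Coh F ∧ Epi (p ≫ g))
    (E : DerivedCategory.Plus X.Modules) (b : ℤ) (hb : E.IsLE b)
    (hcoh : ∀ k : ℤ, Coh ((DerivedCategory.Plus.homologyFunctor _ k).obj E))
    (M : CochainComplex X.Modules ℤ) {n : ℤ} (hn : M.IsStrictlyGE n)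
    (hM : ∀ i, IsAffineLocalizing (M.X i)) (eM : DerivedCategory.Plus.Q.obj ⟨M, n, hn⟩ ≅ E) :
    ∃ (K : CochainComplex X.Modules ℤ) (m : ℤ) (hm : K.IsStrictlyGE m),
      K.IsStrictlyLE b ∧ (∀ i, Coh (K.X i)) ∧ Nonempty (DerivedCategory.Plus.Q.obj ⟨K, m, hm⟩ ≅ E) := by
  haveI := hb
  haveI := hn
  -- the cohomology of `M` is that of `E`: `M` is cohomologically `≤ b`
  have eH : ∀ i, (DerivedCategory.Plus.homologyFunctor _ i).obj E ≅ M.homology i := fun i =>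
    (DerivedCategory.Plus.homologyFunctor _ i).mapIso eM.symm ≪≫ plusHomologyFunctorQObjIso ⟨M, n, hn⟩ i
  haveI : M.IsLE b := by
    rw [CochainComplex.isLE_iff]
    intro i hi
    exact (M.exactAt_iff_isZero_homology i).2
      ((DerivedCategory.Plus.isZero_homology_of_isLE E b i hi).of_iso (eH i).symm)
  -- the truncation `τ^{≤b} M`, a bounded quasi-coherent representative of `E`
  haveI hn' : (M.truncLE b).IsStrictlyGE n := isStrictlyGE_truncLE M n b
  let ι' : (⟨M.truncLE b, n, hn'⟩ : CochainComplex.Plus X.Modules) ⟶ ⟨M, n, hn⟩ :=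
    ObjectProperty.homMk (M.ιTruncLE b)
  haveI : QuasiIso ι'.hom := inferInstanceAs (QuasiIso (M.ιTruncLE b))
  haveI := Functor.isIso_Q_map_of_quasiIso (C := X.Modules) ι'
  exact exists_cohModel_of_qcRepresentative (b := b) hlift E hcoh (M.truncLE b) hn'
    (isAffineLocalizing_truncLE_X M hM b) (asIso (DerivedCategory.Plus.Q.map ι') ≪≫ eM)

/-! ## §3 Projective `k`-schemes -/

section Projective

variable {k : Type u} [Field k] {Y : SchemeOver k}

/-- **SGA 6 II Cor. 2.2.2.1 on a projective `k`-scheme (regularity-free; singular `Y` allowed): every object of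
`D⁺(Mod 𝒪_Y)` with bounded coherent cohomology is the class of a bounded complex of COHERENT modules.** For `Y`
projective over a field `k` and `E ∈ D⁺(Mod 𝒪_Y)` with `E.IsGE a`, `E.IsLE b` and coherent cohomology sheaves, there is
a complex `K` of coherent `𝒪_Y`-modules concentrated in degrees `[m, b]` with `Q⁺⟨K, m, _⟩ ≅ E`. Stage I on the
projective `Y` (`IsProjectiveOver.exists_qcRepresentative`: a bounded-below quasi-coherent representative), then §2 with
the lifting property supplied by Serre's theorem (`IsProjectiveOver.exists_isFiniteLocallyFree_epi_comp`: the dominating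
module is even finite locally free, hence coherent, `coh_of_isFiniteLocallyFree`).
[cite: SGA6, Exp. II Cor. 2.2.2.1] [cite: HuybrechtsFM2006, Prop. 3.26] [cite: StacksProject, Tag 0FDA]
[cite: Hartshorne1977, II Cor. 5.18 (p. 121)] -/
theorem IsProjectiveOver.exists_boundedCohComplex_of_boundedCoh (hY : IsProjectiveOver Y)
    [HasDerivedCategory.{w} Y.left.Modules] (E : DerivedCategory.Plus Y.left.Modules) (a b : ℤ)
    (hE : E.IsGE a) (hb : E.IsLE b) (hcoh : ∀ i : ℤ, Coh ((DerivedCategory.Plus.homologyFunctor _ i).obj E)) :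
    ∃ (K : CochainComplex Y.left.Modules ℤ) (m : ℤ) (hm : K.IsStrictlyGE m),
      K.IsStrictlyLE b ∧ (∀ i, Coh (K.X i)) ∧ Nonempty (DerivedCategory.Plus.Q.obj ⟨K, m, hm⟩ ≅ E) := by
  haveI := hE
  haveI : IsProper Y.hom := hY.isProper
  haveI : IsLocallyNoetherian Y.left := LocallyOfFiniteType.isLocallyNoetherian Y.hom
  obtain ⟨M, hn, -, hM, ⟨eM⟩⟩ := IsProjectiveOver.exists_qcRepresentative hY E a (fun i => (hcoh i).loc)
  refine exists_cohModel_of_qcRepresentative_of_isLE (fun g _ hF hG => ?_) E b hb hcoh M hn hM eM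
  obtain ⟨F, p, hF, hp⟩ := IsProjectiveOver.exists_isFiniteLocallyFree_epi_comp hY g hF hG
  exact ⟨F, p, coh_of_isFiniteLocallyFree hF, hp⟩

end Projective

end Literature.AlgebraicGeometry.Modules

end
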